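import Summits.QuantumFields.YangMills.Theorems.AlphaInputsT3ACv3PerturbedPlaquette
import HarnessLib

/-!
# `AlphaInputsT3ACv3TubeLetters` — START v3 for the (FL) `hLift` binder, first letters: **ONE-PARAMETER FIELDS HAVE EXACTLY ABELIAN PLAQUETTES** — if on the four bonds of a plaquette
# a field reads `g(b₋)·exp(t_b F)·g(b₊)⁻¹` for ONE `F ∈ 𝔰𝔲(n)`, real coefficients `t_b` and any frame `g`, then `U(∂p) = g(x)·exp((t₁+t₂−t₃−t₄)F)·g(x)⁻¹` EXACTLY and
# `dist1 U(∂p) ≤ e^{|t₁+t₂−t₃−t₄|·‖F‖} − 1`; translation-invariant slabs have trivial mixed plaquettes — lane `pub-balaban3d` ∕ cell `ym3-torus`, seat `ym-ust-19936-w1` (g2, LEAD)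

WHY (this seat's memo v3 `HOME/ym-ust-19936-w1/NONABELIAN-FL-START-w1-g2.md`, 2026-08-28, located point L-3 and §3 (T)).  The START of the regional Newton scheme for `hLift` cannot be glued
from per-stencil candidates (first-order disagreement on face-crossing bonds); the canonical START is the SECTION `iterSec k V` with its singular set (the corner lines of the level-`k`
cell complex) smoothed IN PLACE.  Around an interior edge `e` (↔ coarse plaquette `P_e`) the tube field is `U(b) = exp(−β_e(b)·𝐅_e(cell b₋))·W₀(b)`, and in the block frame trivialising
three of the four faces at `e` EVERY bond variable of the tube lies in the one-parameter subgroup `t ↦ exp(t·F)`, `F = mlog V(∂P_e)`: its plaquettes are therefore EXACTLY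
`exp((curl t)(p)·F)`, with NO Baker–Campbell–Hausdorff remainder — the mechanism that keeps the smoothed section inside the `k`-uniform budget `B·ε·L^{−2k}`.  THIS FILE supplies the
frame-free algebra of that statement: §1 the one-parameter subgroup through `F` (`exp((s+t)F) = exp(sF)exp(tF)`, inverses, `expSU` versions); §2 ★★ `plaqHol_eq_conj_expSU_of_oneParam`:
the four-bond identity for ANY frame `g : sites → SU(n)` (so it applies in the ORIGINAL frame, where the tube is the block-frame pull-back), and ★ `dist1_plaqHol_le_of_oneParam`; §3 the
two «mixed plaquette» letters (`plaqHol_eq_one_of_transl_μ/ν`: a slab that is translation invariant along a direction in which the field is trivial has trivial plaquettes containing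
that direction).
HONEST FRAMING.  Elementary matrix∕group algebra; the tube profile `β`, the tube field, the vertex balls and the defect estimate (memo rows S1–S6) are NOT here; (FL)∕`hLift` NOT proved;
count-neutral helper toward R3 2′ (items 19936∕19935); registry untouched; nothing about d = 4, the continuum, or a mass gap; YM₃ on T³ is rung R3, not Clay.

References: T. Bałaban, Commun. Math. Phys. 98 (1985) 17–51 [Balaban1985Averaging] ((8)–(9) p.18, (19) p.21); Commun. Math. Phys. 102 (1985) 277–309 [Balaban1985Variational]
((11)–(14) pp.279–280: the section); W. Rossmann, Lie Groups (2002) [Rossmann2002] (§1.1: one-parameter subgroups).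
-/

set_option autoImplicit false

noncomputable section

open scoped Matrix.Norms.L2Operator
open NormedSpace

namespace Summit.QuantumFields.YangMills.Theorems.TubeStart

open Literature.MathematicalPhysics.QuantumFieldTheory.Balaban1983to89
open Literature.MathematicalPhysics.QuantumFieldTheory.Balaban1983to89.T4AdjointCovarianceUnitary (lieSU expSU coe_expSU mem_lieSU_iff)
open Literature.Analysis.Calculus.ExpDifferential (norm_exp_sub_one_le_exp_norm_sub_one)
open Summit.QuantumFields.YangMills.Theorems.PerturbedPlaquette (dist1_SU_eq norm_conj_SU)

/-! ## §1 The one-parameter subgroup through `F` -/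

section OneParam

variable {n : Type*} [Fintype n] [DecidableEq n]

/-- Real multiples of one matrix commute. [cite: Rossmann2002, §1.1] -/
theorem commute_smul_smul (F : Matrix n n ℂ) (s t : ℝ) : Commute (s • F) (t • F) :=
  ((Commute.refl F).smul_left s).smul_right t

/-- **THE ONE-PARAMETER SUBGROUP LAW**: `exp((s+t)F) = exp(sF)·exp(tF)`. [cite: Rossmann2002, §1.1] -/
theorem exp_add_smul (F : Matrix n n ℂ) (s t : ℝ) : exp ((s + t) • F) = exp (s • F) * exp (t • F) := by
  letI : NormedAlgebra ℚ (Matrix n n ℂ) := NormedAlgebra.restrictScalars ℚ ℂ (Matrix n n ℂ)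
  rw [add_smul, exp_add_of_commute (commute_smul_smul F s t)]

/-- `exp(−tF)·exp(tF) = 1`. [cite: Rossmann2002, §1.1] -/
theorem exp_neg_smul_mul (F : Matrix n n ℂ) (t : ℝ) : exp ((-t) • F) * exp (t • F) = 1 := by
  rw [← exp_add_smul, neg_add_cancel, zero_smul, exp_zero]

/-- `exp(tF)·exp(−tF) = 1`. [cite: Rossmann2002, §1.1] -/
theorem exp_smul_mul_neg (F : Matrix n n ℂ) (t : ℝ) : exp (t • F) * exp ((-t) • F) = 1 := by
  rw [← exp_add_smul, add_neg_cancel, zero_smul, exp_zero]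

/-- The subgroup law in `SU(n)`: `expSU((s+t)F) = expSU(sF)·expSU(tF)` for `F ∈ 𝔰𝔲(n)`. [cite: Rossmann2002, §1.1] -/
theorem expSU_add_smul (F : lieSU n) (s t : ℝ) : expSU ((s + t) • F) = expSU (s • F) * expSU (t • F) := by
  apply Subtype.ext
  rw [Submonoid.coe_mul, coe_expSU, coe_expSU, coe_expSU, Submodule.coe_smul, Submodule.coe_smul, Submodule.coe_smul]
  exact exp_add_smul (F : Matrix n n ℂ) s t

/-- `expSU 0 = 1`. [folklore] -/
theorem expSU_zero' : expSU (0 : lieSU n) = 1 := by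
  apply Subtype.ext
  rw [coe_expSU, Submodule.coe_zero, exp_zero]
  rfl

/-- Inverses along the subgroup: `(expSU(tF))⁻¹ = expSU(−tF)`. [cite: Rossmann2002, §1.1] -/
theorem expSU_smul_inv (F : lieSU n) (t : ℝ) : (expSU (t • F))⁻¹ = expSU ((-t) • F) := by
  rw [eq_comm, ← mul_eq_one_iff_eq_inv, ← expSU_add_smul, neg_add_cancel, zero_smul, expSU_zero']

/-- `expSU(sF)·(expSU(tF))⁻¹ = expSU((s−t)F)`. [cite: Rossmann2002, §1.1] -/
theorem expSU_smul_mul_inv (F : lieSU n) (s t : ℝ) : expSU (s • F) * (expSU (t • F))⁻¹ = expSU ((s - t) • F) := by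
  rw [expSU_smul_inv, ← expSU_add_smul, sub_eq_add_neg]

/-- **DISTANCE ALONG THE SUBGROUP**: `dist1 (expSU(tF)) ≤ e^{‖tF‖} − 1` (operator norm). [cite: Balaban1985Averaging, (19) p.21] -/
theorem dist1_expSU_le [Nonempty n] (X : lieSU n) : GaugeGroup.dist1 (expSU X) ≤ Real.exp ‖(X : Matrix n n ℂ)‖ - 1 := by
  rw [dist1_SU_eq, coe_expSU]
  exact norm_exp_sub_one_le_exp_norm_sub_one _

/-- The same with `‖X‖ ≤ 1`: `dist1 (expSU X) ≤ 2‖X‖` (`e^{x} − 1 ≤ 2x` on `[0,1]`). [cite: Balaban1985Averaging, (19)+(24) p.21] -/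
theorem dist1_expSU_le_two_mul [Nonempty n] (X : lieSU n) (hX : ‖(X : Matrix n n ℂ)‖ ≤ 1) : GaugeGroup.dist1 (expSU X) ≤ 2 * ‖(X : Matrix n n ℂ)‖ := by
  refine (dist1_expSU_le X).trans ?_
  have h0 : 0 ≤ ‖(X : Matrix n n ℂ)‖ := norm_nonneg _
  -- `|e^x − 1 − x| ≤ x²` for `|x| ≤ 1`
  have h := Real.abs_exp_sub_one_sub_id_le (x := ‖(X : Matrix n n ℂ)‖) (by rw [abs_of_nonneg h0]; exact hX)
  have h' := (abs_le.mp h).2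
  nlinarith [h', hX, h0]

end OneParam

/-! ## §2 The four-bond identity: one-parameter fields have exactly abelian plaquettes, in ANY frame -/

section Plaquette

variable {n : Type*} [Fintype n] [DecidableEq n] [Nonempty n]

omit [Fintype n] [DecidableEq n] [Nonempty n] in
/-- **★ THE GROUP IDENTITY.**  `(g₀E₁g₁⁻¹)(g₁E₂g₂⁻¹)(g₃E₃g₂⁻¹)⁻¹(g₀E₄g₃⁻¹)⁻¹ = g₀(E₁E₂E₃⁻¹E₄⁻¹)g₀⁻¹` in any group. [folklore] -/
theorem conj_plaq_word {G : Type*} [Group G] (g₀ g₁ g₂ g₃ E₁ E₂ E₃ E₄ : G) :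
    (g₀ * E₁ * g₁⁻¹) * (g₁ * E₂ * g₂⁻¹) * (g₃ * E₃ * g₂⁻¹)⁻¹ * (g₀ * E₄ * g₃⁻¹)⁻¹ = g₀ * (E₁ * E₂ * E₃⁻¹ * E₄⁻¹) * g₀⁻¹ := by
  group

omit [Nonempty n] in
/-- **THE ONE-PARAMETER PLAQUETTE WORD**: `E(t₁)E(t₂)E(t₃)⁻¹E(t₄)⁻¹ = E(t₁ + t₂ − t₃ − t₄)`, `E(t) = expSU(tF)`. [cite: Rossmann2002, §1.1] -/
theorem expSU_plaq_word (F : lieSU n) (t₁ t₂ t₃ t₄ : ℝ) :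
    expSU (t₁ • F) * expSU (t₂ • F) * (expSU (t₃ • F))⁻¹ * (expSU (t₄ • F))⁻¹ = expSU ((t₁ + t₂ - t₃ - t₄) • F) := by
  rw [← expSU_add_smul, expSU_smul_mul_inv, expSU_smul_mul_inv]

variable {P : Params} {j : ℕ}

/-- **★★ ONE-PARAMETER FIELDS HAVE EXACTLY ABELIAN PLAQUETTES, IN ANY FRAME.**  If on the four bonds of `p = (x; μ, ν)` the field reads `U(b) = g(b₋)·expSU(t_b F)·g(b₊)⁻¹` for one
`F ∈ 𝔰𝔲(n)`, reals `t₁, t₂, t₃, t₄` (bonds `(x,μ), (x+e_μ,ν), (x+e_ν,μ), (x,ν)`) and ANY `g : sites → SU(n)`, then `U(∂p) = g(x)·expSU((t₁+t₂−t₃−t₄)F)·g(x)⁻¹` — no commutator remainder.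
(The tube of START v3 in the original frame: `g` = the block frame trivialising three faces at the edge, `t = s − β`.) [cite: Balaban1985Averaging, (8)–(9) pp.18–19] -/
theorem plaqHol_eq_conj_expSU_of_oneParam (U : GaugeField P j (Matrix.specialUnitaryGroup n ℂ)) (g : GaugeTransf P j (Matrix.specialUnitaryGroup n ℂ))
    (F : lieSU n) (p : Plaq P j) (t₁ t₂ t₃ t₄ : ℝ)
    (h₁ : U ⟨p.src, p.μ⟩ = g p.src * expSU (t₁ • F) * (g (p.src.shift p.μ))⁻¹)
    (h₂ : U ⟨p.src.shift p.μ, p.ν⟩ = g (p.src.shift p.μ) * expSU (t₂ • F) * (g ((p.src.shift p.μ).shift p.ν))⁻¹)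
    (h₃ : U ⟨p.src.shift p.ν, p.μ⟩ = g (p.src.shift p.ν) * expSU (t₃ • F) * (g ((p.src.shift p.ν).shift p.μ))⁻¹)
    (h₄ : U ⟨p.src, p.ν⟩ = g p.src * expSU (t₄ • F) * (g (p.src.shift p.ν))⁻¹) :
    GaugeField.plaqHol U p = g p.src * expSU ((t₁ + t₂ - t₃ - t₄) • F) * (g p.src)⁻¹ := by
  unfold GaugeField.plaqHol
  rw [h₁, h₂, h₃, h₄, Site.shift_comm p.src p.ν p.μ, conj_plaq_word, expSU_plaq_word]

/-- **★ HENCE `dist1 U(∂p) = dist1 (expSU((t₁+t₂−t₃−t₄)F)) ≤ e^{|t₁+t₂−t₃−t₄|·‖F‖} − 1`** — the plaquette cost of a one-parameter field is its ABELIAN curl times `‖F‖`, frame or no frame.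
[cite: Balaban1985Averaging, (9)+(12) p.19, (19) p.21] -/
theorem dist1_plaqHol_le_of_oneParam (U : GaugeField P j (Matrix.specialUnitaryGroup n ℂ)) (g : GaugeTransf P j (Matrix.specialUnitaryGroup n ℂ))
    (F : lieSU n) (p : Plaq P j) (t₁ t₂ t₃ t₄ : ℝ)
    (h₁ : U ⟨p.src, p.μ⟩ = g p.src * expSU (t₁ • F) * (g (p.src.shift p.μ))⁻¹)
    (h₂ : U ⟨p.src.shift p.μ, p.ν⟩ = g (p.src.shift p.μ) * expSU (t₂ • F) * (g ((p.src.shift p.μ).shift p.ν))⁻¹)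
    (h₃ : U ⟨p.src.shift p.ν, p.μ⟩ = g (p.src.shift p.ν) * expSU (t₃ • F) * (g ((p.src.shift p.ν).shift p.μ))⁻¹)
    (h₄ : U ⟨p.src, p.ν⟩ = g p.src * expSU (t₄ • F) * (g (p.src.shift p.ν))⁻¹) :
    GaugeGroup.dist1 (GaugeField.plaqHol U p) = GaugeGroup.dist1 (expSU ((t₁ + t₂ - t₃ - t₄) • F)) ∧
      GaugeGroup.dist1 (GaugeField.plaqHol U p) ≤ Real.exp (|t₁ + t₂ - t₃ - t₄| * ‖(F : Matrix n n ℂ)‖) - 1 := by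
  have heq : GaugeGroup.dist1 (GaugeField.plaqHol U p) = GaugeGroup.dist1 (expSU ((t₁ + t₂ - t₃ - t₄) • F)) := by
    rw [plaqHol_eq_conj_expSU_of_oneParam U g F p t₁ t₂ t₃ t₄ h₁ h₂ h₃ h₄, GaugeGroup.dist1_conj]
  refine ⟨heq, ?_⟩
  rw [heq]
  refine (dist1_expSU_le _).trans (le_of_eq ?_)
  rw [Submodule.coe_smul, norm_smul, Real.norm_eq_abs]

end Plaquette

/-! ## §3 Mixed plaquettes of a slab that is translation invariant along a trivial direction -/

section Mixed

variable {P : Params} {j : ℕ} {G : Type*} [GaugeGroup G]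

/-- **TRIVIAL `ν`-BONDS + `ν`-TRANSLATION INVARIANCE OF THE `μ`-BONDS ⇒ `U(∂p) = 1`** (`p = (x; μ, ν)`): `U(∂p) = X·1·X⁻¹·1`.  (The tube along an edge of direction `ν`: its
`ν`-bonds are the section's interior bonds `= 1` and its cross-section is repeated along `ν`.) [cite: Balaban1985Averaging, (9) p.19] -/
theorem plaqHol_eq_one_of_transl_ν (U : GaugeField P j G) (p : Plaq P j)
    (hν₁ : U ⟨p.src.shift p.μ, p.ν⟩ = 1) (hν₂ : U ⟨p.src, p.ν⟩ = 1) (hμ : U ⟨p.src.shift p.ν, p.μ⟩ = U ⟨p.src, p.μ⟩) :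
    GaugeField.plaqHol U p = 1 := by
  unfold GaugeField.plaqHol
  rw [hν₁, hν₂, hμ, mul_one, inv_one, mul_one, mul_inv_cancel]

/-- **TRIVIAL `μ`-BONDS + `μ`-TRANSLATION INVARIANCE OF THE `ν`-BONDS ⇒ `U(∂p) = 1`** (the same with the edge along `μ`): `U(∂p) = 1·Y·1·Y⁻¹`. [cite: Balaban1985Averaging, (9) p.19] -/
theorem plaqHol_eq_one_of_transl_μ (U : GaugeField P j G) (p : Plaq P j)
    (hμ₁ : U ⟨p.src, p.μ⟩ = 1) (hμ₂ : U ⟨p.src.shift p.ν, p.μ⟩ = 1) (hν : U ⟨p.src.shift p.μ, p.ν⟩ = U ⟨p.src, p.ν⟩) :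
    GaugeField.plaqHol U p = 1 := by
  unfold GaugeField.plaqHol
  rw [hμ₁, hμ₂, hν, one_mul, inv_one, mul_one, mul_inv_cancel]

end Mixed

end Summit.QuantumFields.YangMills.Theorems.TubeStart

end
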